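/-
Origin: expansion seat `planner-pub-hodgecm-toy2-g3-0`, handover #7 2026-08-18T07:02:33Z (`HOME/pub-hodgecm-toy2-g3/lean/Toy2g3/TruncAlgAtExt.lean`, md5 4628b06a, 241 lines);
landed by the gen-7 packager in gate run 25 as `HodgeCM/Model/Toy/TruncAlgAtExt.lean` (import ^import Toy2g3\.(TruncAlgMilne|TruncAlgAtExt|TruncAlgAt|TruncAlgDual|TruncAlgCM|TruncAlgExt)\b→import HodgeCM.Model.Toy.\1 ×2).
-/
/-
Copyright: pub-hodgecm formalisation cell (harness21, 2026). New file (not vendored).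
Origin: HOME/pub-hodgecm-toy2-g3/lean/Toy2g3/TruncAlgAtExt.lean — session planner-pub-hodgecm-toy2-g3-0 (unit pub-hodgecm-toy2-g3,
CONSISTENCY seat 2, part (6a)(ii), generation 3).  WIP module `Toy2g3.TruncAlgAtExt`; intended final place
`HodgeCM/Model/Toy/TruncAlgAtExt.lean` (module `HodgeCM.Model.Toy.TruncAlgAtExt`; kind L5 consistency / non-vacuity layer).
WIP imports to rewrite on landing: `import Toy2g3.TruncAlgExt` ↦ `import HodgeCM.Model.Toy.TruncAlgExt` (HANDOVER #6),
`import Toy2g3.TruncAlgCM` ↦ `import HodgeCM.Model.Toy.TruncAlgCM` (HANDOVER #5).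
-/
import Summits.HodgeConjecture.HodgeCM.Model.Toy.TruncAlgExt
import Summits.HodgeConjecture.HodgeCM.Model.Toy.TruncAlgCM

/-!
# The [QW8] profile in EVERY finite codimension: `truncAlgAt c`, `c ≥ 2`

`TruncAlgExt` computed the profile of the five obligations of `qw8Sufficiency_of_steps'` in the codimension-two truncation.
Here the same profile is established for the whole family `U.truncAlgAt c` (`Alg^p := U.alg` for `p ≤ c`, `:= 0` for
`p > c`), `c ≥ 2`, of `TruncAlgAt`/`TruncAlgCM`:

* SURVIVE for every `c`: (i) `Qw8Conj` (`truncAlgAt_qw8Conj`), the bridge (`truncAlgAt_qw8FaceBridge`, `c ≥ 2`), (iv)₀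
  `Qw8MilneZero` (`truncAlgAt_qw8MilneZero_iff`), (iii)+(v) `Qw8DualPushPull` (`truncAlgAt_qw8DualPushPull`, from the
  degree-aware dual push-pull of `TruncAlgDual`).
* FAIL for every `c`: Milne's (iv) — `not_qw8MilnePos_truncAlgAt (M) (N1) (c)`: over `ℚ(ζ_p)`, `p` prime `> 2c + 7`
  (`exists_cmField_finrank_gt`), the full-weight vector on the CM atom has codimension `(p-1)/2 > c` and character `0`;
  and step (ii) — `not_qw8ExtProd_truncAlgAt (M) (N1) (N3) (W_RK4) (hc : 2 ≤ c)`: ITERATED DOUBLING of the Weil generator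
  `e_f` (algebraic of codimension `2 ≤ c`): `(ii)` applied `c` times yields an algebraic `z` with
  `Λ(a(z)) = 2^c · Λ(a_f)`, `|Λ(a_f)| = 4` (the sign functional of `TruncAlgExt`), while `|Λ(a(z))| ≤ 2·codim z ≤ 2c < 4·2^c`.

Toy (`truncModelAt c = toyModel.truncAlgAt c`): `truncModelAt_qw8Profile (hc : 2 ≤ c)` — the same TRUE/FALSE table as
`truncModel_qw8Profile` in every codimension; `qw8ExtProd_not_finite_codimension` / `qw8Milne_not_finite_codimension`:
for every `c ≥ 2` a model of the 28 facts + `W_RK4` + `HCUpTo c` (all Hodge classes of codimension `≤ c` algebraic) in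
which (ii), resp. (iv), FAILS — neither additive step is a finite-codimension statement.
All proofs kernel-checked; no cited facts.
-/

noncomputable section

open scoped TensorProduct

namespace HodgeCM

open Literature.AlgebraicGeometry.Motives (CMType)
open CMTypeOps NumberField

namespace Universe

variable {U : Universe}

/-! ## 1. Weight-vector records of `U` and of `U.truncAlgAt c` -/

set_option smartUnfolding false in
/-- Weight-vector records of `U` and of `U.truncAlgAt c` are the same data. -/
def WVec.toTruncAlgAt (c : ℕ) {F : CMField} (z : U.WVec F) : (U.truncAlgAt c).WVec F :=
  ⟨z.n, z.Θ, z.p, z.S, z.x, z.ne_zero, z.isWeightVector⟩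

set_option smartUnfolding false in
/-- Weight-vector records of `U.truncAlgAt c` and of `U` are the same data. -/
def WVec.ofTruncAlgAt {c : ℕ} {F : CMField} (z : (U.truncAlgAt c).WVec F) : U.WVec F :=
  ⟨z.n, z.Θ, z.p, z.S, z.x, z.ne_zero, z.isWeightVector⟩

set_option smartUnfolding false in
/-- (Ported verbatim from the HodgeCMPerL package; no docstring in the source.) -/
theorem WVec.isAlg_toTruncAlgAt_iff {c : ℕ} {F : CMField} (z : U.WVec F) (hp : z.p ≤ c) :
    (z.toTruncAlgAt c).IsAlg ↔ z.IsAlg := by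
  change z.x ∈ (U.truncAlgAt c).algC (U.cmProd F z.Θ) z.p ↔ z.x ∈ U.algC (U.cmProd F z.Θ) z.p
  rw [algC, algC, U.truncAlgAt_alg_of_le hp]
  exact Iff.rfl

set_option smartUnfolding false in
/-- (Ported verbatim from the HodgeCMPerL package; no docstring in the source.) -/
theorem WVec.isAlg_ofTruncAlgAt_iff {c : ℕ} {F : CMField} (z : (U.truncAlgAt c).WVec F) (hp : z.p ≤ c) :
    (WVec.ofTruncAlgAt z).IsAlg ↔ z.IsAlg := by
  change z.x ∈ U.algC (U.cmProd F z.Θ) z.p ↔ z.x ∈ (U.truncAlgAt c).algC (U.cmProd F z.Θ) z.p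
  rw [algC, algC, U.truncAlgAt_alg_of_le hp]
  exact Iff.rfl

set_option smartUnfolding false in
/-- In codimension `> c` no weight vector of `U.truncAlgAt c` is algebraic. -/
theorem WVec.not_isAlg_truncAlgAt {c : ℕ} {F : CMField} (z : (U.truncAlgAt c).WVec F) (hp : c < z.p) : ¬ z.IsAlg := by
  intro h
  have h' : z.x ∈ (U.truncAlgAt c).algC ((U.truncAlgAt c).cmProd F z.Θ) z.p := h
  rw [U.truncAlgAt_algC_of_lt hp, Submodule.mem_bot] at h'
  exact z.ne_zero h'

/-- (Ported verbatim from the HodgeCMPerL package; no docstring in the source.) -/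
theorem WVec.p_le_of_isAlg_truncAlgAt {c : ℕ} {F : CMField} (z : (U.truncAlgAt c).WVec F) (hz : z.IsAlg) : z.p ≤ c := by
  by_contra h
  exact WVec.not_isAlg_truncAlgAt z (by omega) hz

/-! ## 2. The steps that survive in every codimension -/

/-- (Ported verbatim from the HodgeCMPerL package; no docstring in the source.) -/
theorem truncAlgAt_qw8Conj (c : ℕ) : (U.truncAlgAt c).Qw8Conj := (U.truncAlgAt c).qw8Conj_holds

/-- (Ported verbatim from the HodgeCMPerL package; no docstring in the source.) -/
theorem truncAlgAt_qw8FaceBridge (M : U.ModelAxioms) {c : ℕ} (hc : 2 ≤ c) (h0 : ∀ (X : U.Var) (k : ℕ), U.tr X k = 0) :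
    (U.truncAlgAt c).Qw8FaceBridge :=
  qw8FaceBridge_holds (M.truncAlgAt hc h0)

/-- (Ported verbatim from the HodgeCMPerL package; no docstring in the source.) -/
theorem truncAlgAt_qw8MilneZero_iff (c : ℕ) : (U.truncAlgAt c).Qw8MilneZero ↔ U.Qw8MilneZero := by
  constructor
  · intro h F hG h6 z hp
    exact (WVec.isAlg_toTruncAlgAt_iff z (by rw [hp]; exact Nat.zero_le c)).mp (h F hG h6 (z.toTruncAlgAt c) hp)
  · intro h F hG h6 z hp
    exact (WVec.isAlg_ofTruncAlgAt_iff z (by rw [hp]; exact Nat.zero_le c)).mp (h F hG h6 (WVec.ofTruncAlgAt z) hp)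

set_option smartUnfolding false in
/-- **`Qw8DualPushPull` HOLDS in every `U.truncAlgAt c`** (facts as in `truncAlg_qw8DualPushPull`). -/
theorem truncAlgAt_qw8DualPushPull (M : U.ModelAxioms) (hN1 : U.Fact_cupExterior) (hN3 : U.Fact_pull_H0)
    (h4 : U.Fact_cupAlg) (h5 : U.Fact_cupAssoc) (h7d : U.Fact_gysinDescent) (hd : U.Fact_dimProd)
    (hM0 : U.Qw8MilneZero) (c : ℕ) : (U.truncAlgAt c).Qw8DualPushPull := by
  intro F hG h6 e' W' hW'
  have hWp : W'.p ≤ c := WVec.p_le_of_isAlg_truncAlgAt W' hW'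
  have hW : (WVec.ofTruncAlgAt W').IsAlg := (WVec.isAlg_ofTruncAlgAt_iff W' hWp).mpr hW'
  obtain ⟨Z, hZa, hZp, hZimp⟩ :=
    U.qw8DualPushPull_deg M hN1 hN3 h4 h5 h7d hd hM0 F hG h6 (WVec.ofTruncAlgAt e') (WVec.ofTruncAlgAt W') hW
  refine ⟨Z.toTruncAlgAt c, hZa, fun hZ' => ?_⟩
  have hZpc : Z.p ≤ c := WVec.p_le_of_isAlg_truncAlgAt (Z.toTruncAlgAt c) hZ'
  have hZ : Z.IsAlg := (WVec.isAlg_toTruncAlgAt_iff Z hZpc).mp hZ'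
  have hep : e'.p ≤ c := by
    change (WVec.ofTruncAlgAt e').p ≤ c
    omega
  exact (WVec.isAlg_ofTruncAlgAt_iff e' hep).mp (hZimp hZ)

/-! ## 3. The two additive steps fail in every codimension -/

/-- **Milne's step (iv) in positive degree FAILS in every `U.truncAlgAt c`** (for `U` with `ModelAxioms`, N1): over a
Galois CM field of degree `> 2c + 1` the full-weight vector on the CM atom `A_Φ` has codimension `> c` and character `0`. -/
theorem not_qw8MilnePos_truncAlgAt (M : U.ModelAxioms) (hN1 : U.Fact_cupExterior) (c : ℕ) :
    ¬ (U.truncAlgAt c).Qw8MilnePos := by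
  intro hMi
  obtain ⟨F, hG, h6, hb⟩ := exists_cmField_finrank_gt (2 * c + 1)
  haveI := hG
  have hc : c < Module.finrank ℚ F / 2 := by omega
  obtain ⟨x, hx, hx0⟩ := exists_weightVector_univ_single M hN1 h6 (stdCMType F)
  have hx' : (U.truncAlgAt c).IsWeightVector F (fun _ : Fin (0 + 1) => stdCMType F) (fun _ => Finset.univ)
      (2 * (Module.finrank ℚ F / 2)) x := by
    rw [← mem_weightSpace_iff, truncAlgAt_weightSpace]
    exact hx
  let z : (U.truncAlgAt c).WVec F :=
    ⟨0, fun _ => stdCMType F, Module.finrank ℚ F / 2, fun _ => Finset.univ, x, hx0, hx'⟩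
  exact WVec.not_isAlg_truncAlgAt z hc
    (hMi F hG h6 z (by change 0 < Module.finrank ℚ F / 2; omega)
      (by change lefChar (fun _ : Fin (0 + 1) => stdCMType F) (fun _ => Finset.univ) = 0; exact lefChar_univ_eq_zero _))

/-- Hence **`Qw8Milne` FAILS in every `U.truncAlgAt c`**. -/
theorem not_qw8Milne_truncAlgAt (M : U.ModelAxioms) (hN1 : U.Fact_cupExterior) (c : ℕ) : ¬ (U.truncAlgAt c).Qw8Milne :=
  fun h => not_qw8MilnePos_truncAlgAt M hN1 c (qw8MilnePos_of_qw8Milne h)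

set_option smartUnfolding false in
/-- **Step (ii) `Qw8ExtProd` FAILS in every `U.truncAlgAt c`, `c ≥ 2`** (for `U` with `ModelAxioms`, N1, N3, `W_RK4`):
iterated doubling of the Weil generator. -/
theorem not_qw8ExtProd_truncAlgAt (M : U.ModelAxioms) (hN1 : U.Fact_cupExterior) (hN3 : U.Fact_pull_H0) (hW : U.W_RK4)
    {c : ℕ} (hc : 2 ≤ c) : ¬ (U.truncAlgAt c).Qw8ExtProd := by
  intro hE
  obtain ⟨F, hG, h6, f, -⟩ := HodgeCM.faceHypothesesInhabited
  haveI := hG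
  obtain ⟨x, hx0, hxw, hxalg⟩ := U.qw8FaceBridge_holds M F hG h6 f (hW F hG h6 f) f.p
  let v : U.WVec F := ⟨3, f.corner, 2, fun _ => {f.p}, x, hx0, hxw⟩
  have hv : (v.toTruncAlgAt c).IsAlg := (WVec.isAlg_toTruncAlgAt_iff v hc).mpr hxalg
  obtain ⟨Λ, hΛ, hΛf⟩ := exists_signFunctional_face F h6 f f.p
  -- iterated doubling
  have key : ∀ k : ℕ, ∃ z : (U.truncAlgAt c).WVec F,
      z.IsAlg ∧ Λ z.achar = 2 ^ k * Λ (lefChar f.corner (fun _ => ({f.p} : Finset ((F : Type) →+* ℂ)))) := by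
    intro k
    induction k with
    | zero => exact ⟨v.toTruncAlgAt c, hv, by rw [pow_zero, one_mul]; rfl⟩
    | succ k ih =>
      obtain ⟨z, hz, hzΛ⟩ := ih
      obtain ⟨z', hz', hza'⟩ := hE F hG h6 z z hz hz
      refine ⟨z', hz', ?_⟩
      rw [hza', map_add, hzΛ, pow_succ]
      ring
  obtain ⟨z, hz, hzΛ⟩ := key c
  have hzp : z.p ≤ c := WVec.p_le_of_isAlg_truncAlgAt z hz
  have hcard := WVec.sum_card_eq M hN1 hN3 (WVec.ofTruncAlgAt z)
  change (∑ j, (z.S j).card) = 2 * z.p at hcard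
  have h1 : |Λ z.achar| ≤ 2 * (z.p : ℤ) := by
    have h := hΛ z.Θ z.S
    have hc' : (∑ j, ((z.S j).card : ℤ)) = ((2 * z.p : ℕ) : ℤ) := by rw [← hcard]; push_cast; rfl
    rw [hc'] at h
    exact_mod_cast h
  rw [hzΛ, abs_mul, hΛf, abs_of_pos (pow_pos two_pos c)] at h1
  have hlt : (c : ℤ) < (2 : ℤ) ^ c := by exact_mod_cast Nat.lt_two_pow_self
  have hzp' : (z.p : ℤ) ≤ c := by exact_mod_cast hzp
  generalize (2 : ℤ) ^ c = N at h1 hlt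
  omega

/-- … although the truncation satisfies `HCUpTo c` whenever `U` satisfies the Hodge conjecture. -/
theorem not_qw8ExtProd_truncAlgAt_and_hcUpTo (M : U.ModelAxioms) (hN1 : U.Fact_cupExterior) (hN3 : U.Fact_pull_H0)
    (hW : U.W_RK4) (hHC : ∀ X : U.Var, U.HC X) {c : ℕ} (hc : 2 ≤ c) :
    (U.truncAlgAt c).HCUpTo c ∧ ¬ (U.truncAlgAt c).Qw8ExtProd :=
  ⟨(U.truncAlgAt_hcUpTo_iff c).mpr (U.hcUpTo_of_hc hHC c), not_qw8ExtProd_truncAlgAt M hN1 hN3 hW hc⟩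

end Universe

/-! ## 4. Toy: the profile of `truncModelAt c`; (ii) and (iv) are not finite-codimension statements -/

namespace Toy

open Universe

/-- (Ported verbatim from the HodgeCMPerL package; no docstring in the source.) -/
theorem truncModelAt_qw8Conj (c : ℕ) : (truncModelAt c).Qw8Conj := toyModel.truncAlgAt_qw8Conj c

/-- (Ported verbatim from the HodgeCMPerL package; no docstring in the source.) -/
theorem truncModelAt_qw8FaceBridge {c : ℕ} (hc : 2 ≤ c) : (truncModelAt c).Qw8FaceBridge :=
  toyModel.truncAlgAt_qw8FaceBridge toyModel_modelAxioms hc toyModel_tr_eq_zero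

/-- (Ported verbatim from the HodgeCMPerL package; no docstring in the source.) -/
theorem truncModelAt_qw8MilneZero (c : ℕ) : (truncModelAt c).Qw8MilneZero :=
  (toyModel.truncAlgAt_qw8MilneZero_iff c).mpr toyModel_qw8MilneZero

/-- (Ported verbatim from the HodgeCMPerL package; no docstring in the source.) -/
theorem truncModelAt_qw8DualPushPull (c : ℕ) : (truncModelAt c).Qw8DualPushPull :=
  toyModel.truncAlgAt_qw8DualPushPull toyModel_modelAxioms toyModel_fact_cupExterior toyModel_fact_pull_H0 fact_cupAlg
    (fact_cupAssoc exteriorHodgeData) toyModel_fact_gysinDescent toyModel_fact_dimProd toyModel_qw8MilneZero c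

/-- (Ported verbatim from the HodgeCMPerL package; no docstring in the source.) -/
theorem not_truncModelAt_qw8Milne (c : ℕ) : ¬ (truncModelAt c).Qw8Milne :=
  toyModel.not_qw8Milne_truncAlgAt toyModel_modelAxioms toyModel_fact_cupExterior c

/-- (Ported verbatim from the HodgeCMPerL package; no docstring in the source.) -/
theorem not_truncModelAt_qw8ExtProd {c : ℕ} (hc : 2 ≤ c) : ¬ (truncModelAt c).Qw8ExtProd :=
  toyModel.not_qw8ExtProd_truncAlgAt toyModel_modelAxioms toyModel_fact_cupExterior toyModel_fact_pull_H0 toyModel_w_rk4 hc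

/-- **The [QW8] profile of `truncModelAt c`, `c ≥ 2`**: (i), (iii)+(v), (iv)₀, bridge HOLD; (ii), (iv) FAIL — the same
table as `truncModel_qw8Profile`, in every finite codimension. -/
theorem truncModelAt_qw8Profile {c : ℕ} (hc : 2 ≤ c) :
    ((truncModelAt c).Qw8Conj ∧ (truncModelAt c).Qw8DualPushPull ∧ (truncModelAt c).Qw8MilneZero ∧
        (truncModelAt c).Qw8FaceBridge) ∧
      (¬ (truncModelAt c).Qw8ExtProd ∧ ¬ (truncModelAt c).Qw8Milne) :=
  ⟨⟨truncModelAt_qw8Conj c, truncModelAt_qw8DualPushPull c, truncModelAt_qw8MilneZero c, truncModelAt_qw8FaceBridge hc⟩,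
    ⟨not_truncModelAt_qw8ExtProd hc, not_truncModelAt_qw8Milne c⟩⟩

/-- **Step (ii) is not a finite-codimension statement**: for every `c ≥ 2` there is a model of the 28 facts with `W_RK4`
in which every Hodge class of codimension `≤ c` is algebraic and `Qw8ExtProd` FAILS. -/
theorem qw8ExtProd_not_finite_codimension {c : ℕ} (hc : 2 ≤ c) :
    ∃ U : Universe, U.ModelAxioms ∧ U.W_RK4 ∧ U.HCUpTo c ∧ U.Qw8DualPushPull ∧ U.Qw8MilneZero ∧ ¬ U.Qw8ExtProd :=
  ⟨truncModelAt c, truncModelAt_modelAxioms hc, truncModelAt_w_rk4 hc, truncModelAt_hcUpTo c,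
    truncModelAt_qw8DualPushPull c, truncModelAt_qw8MilneZero c, not_truncModelAt_qw8ExtProd hc⟩

/-- **Milne's step (iv) is not a finite-codimension statement** either. -/
theorem qw8Milne_not_finite_codimension {c : ℕ} (hc : 2 ≤ c) :
    ∃ U : Universe, U.ModelAxioms ∧ U.W_RK4 ∧ U.HCUpTo c ∧ U.Qw8DualPushPull ∧ U.Qw8MilneZero ∧ ¬ U.Qw8Milne :=
  ⟨truncModelAt c, truncModelAt_modelAxioms hc, truncModelAt_w_rk4 hc, truncModelAt_hcUpTo c,
    truncModelAt_qw8DualPushPull c, truncModelAt_qw8MilneZero c, not_truncModelAt_qw8Milne c⟩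

end Toy

end HodgeCM

end
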